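import Mathlib
import HarnessLib

/-!
# The trivial-sector fraction is at least `1 − ⟨Q²⟩`: the finite-box / `P-c` bookkeeping of row 16's Q0-REPORT

HONEST FRAMING: exact (Metropolis-corrected) sampling algorithms for lattice gauge theory;
figures of merit are autocorrelation/cost numbers at stated couplings and volumes; no
continuum-physics claim.

Venture `LatticeQCDFlow` (cell pub-lqcd), sub-topic `Scoring`; FANOUT row 16 (`su2-base`).  The row's finite-box
deliverable `Q0-REPORT.md` tabulates, per `(β, L/a)` point, the fraction `P(Q = 0)` of stored measurements in the
trivial topological sector and the second moment `⟨Q²⟩` of the integer charge, and the campaign rule `P-c` moves the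
fine point `F3` to `24⁴` when `⟨Q²⟩ < 0.5`.  NEW WORK of the cell (placement rule): the elementary inequality that
ties the two columns together, for samples (what the report computes) and for laws (what it estimates); nothing is
cited as a fact.  Mathlib only.

## What is proved

* §1 pointwise: for an integer `q`, `𝟙[q ≠ 0] ≤ q²` (`indicator_ne_zero_le_sq`), with equality iff `|q| ≤ 1`.
* §2 finite samples `q : ι → ℤ` over a finite index set `s` (row 16's stored measurements):
  **`card_ne_zero_le_sum_sq`** (`#{i : qᵢ ≠ 0} ≤ ∑ qᵢ²`), the slack identity `sum_sq_sub_card_ne_zero`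
  (`∑ qᵢ² − #{qᵢ ≠ 0} = ∑_{qᵢ ≠ 0} (qᵢ² − 1)`), **`one_sub_meanSq_le_zeroFraction`** (`P̂(Q = 0) ≥ 1 − ⟨Q²⟩̂`),
  `zeroFraction_eq_one_sub_meanSq_iff` (equality iff every `|qᵢ| ≤ 1`), and **`half_lt_zeroFraction`**: the `P-c`
  trigger `⟨Q²⟩̂ < ½` forces a MAJORITY of the measurements into the trivial sector — the finite-box regime the
  Berg–Clarke caveat warns about is exactly where `P-c` fires.
* §3 laws: for an integer-valued random variable `Q` with `Q²` integrable on a probability space,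
  **`one_sub_integral_sq_le_measureReal_zero`** (`ℙ(Q = 0) ≥ 1 − 𝔼 Q²`) and `measureReal_ne_zero_le_integral_sq`.
* §4 the report's `(β, L/a) = (2.5, 8)` rows as arithmetic instances (`q0report_*`): sector counts
  `{−2:1, −1:28, 0:853, 1:18}` (E1, `N = 900`) give `∑q² = 50`, `#{q ≠ 0} = 47`, slack `3` (one `|Q| = 2` visit), so
  `P̂(0) = 853/900 ≥ 1 − 50/900`; counts `{−1:48, 0:1835, 1:77}` (E2, `N = 1960`) have no `|Q| ≥ 2` and the bound is
  an EQUALITY, `1835/1960 = 1 − 125/1960` — as printed (0.936 both).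

NOT CLAIMED: anything about autocorrelation (the report's error bars), the physical origin of `Q ≡ 0` in small boxes,
or which definition of `Q` is used; any new number (§4 only re-derives two printed rows).
-/

namespace Summit.Ventures.LatticeQCDFlow.Scoring

open MeasureTheory Finset

/-! ## §1 Pointwise -/

/-- For an integer `q`: `𝟙[q ≠ 0] ≤ q²`. -/
theorem indicator_ne_zero_le_sq (q : ℤ) : (if q ≠ 0 then (1 : ℝ) else 0) ≤ (q : ℝ) ^ 2 := by
  split_ifs with h
  · have h1 : (1 : ℤ) ≤ q ^ 2 := by
      rcases lt_or_gt_of_ne h with hlt | hgt <;> nlinarith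
    exact_mod_cast h1
  · positivity

/-- The slack `q² − 𝟙[q ≠ 0]` vanishes iff `|q| ≤ 1`. -/
theorem sq_sub_indicator_eq_zero_iff (q : ℤ) : (q : ℝ) ^ 2 - (if q ≠ 0 then (1 : ℝ) else 0) = 0 ↔ |q| ≤ 1 := by
  split_ifs with h
  · constructor
    · intro hq
      have h1 : ((q : ℝ)) ^ 2 = 1 := by linarith
      have h2 : (q : ℤ) ^ 2 = 1 := by exact_mod_cast h1
      nlinarith [sq_abs q, abs_nonneg q]
    · intro hq
      have h1 : |q| = 1 := le_antisymm hq (Int.one_le_abs h)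
      have h2 : (q : ℤ) ^ 2 = 1 := by rw [← sq_abs, h1]; norm_num
      have h3 : ((q : ℝ)) ^ 2 = 1 := by exact_mod_cast h2
      linarith
  · push Not at h
    subst h
    simp

/-! ## §2 Finite samples -/

section Sample

variable {ι : Type*} (s : Finset ι) (q : ι → ℤ)

/-! Notation of the statements below: the trivial-sector fraction is `P̂(Q = 0) = #{i ∈ s : qᵢ = 0} / #s` and the
sample second moment is `⟨Q²⟩̂ = (∑_{i ∈ s} qᵢ²) / #s` (written out in full; no definition is introduced). -/

/-- `#{qᵢ ≠ 0}` as a sum of indicators. -/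
theorem card_ne_zero_eq_sum : ((s.filter fun i => q i ≠ 0).card : ℝ) = ∑ i ∈ s, (if q i ≠ 0 then (1 : ℝ) else 0) := by
  rw [Finset.sum_ite, Finset.sum_const_zero, add_zero, Finset.sum_const, nsmul_eq_mul, mul_one]

/-- **`#{i : qᵢ ≠ 0} ≤ ∑ qᵢ²`** (every visit to a non-trivial sector contributes at least `1` to `∑ Q²`). -/
theorem card_ne_zero_le_sum_sq : ((s.filter fun i => q i ≠ 0).card : ℝ) ≤ ∑ i ∈ s, (q i : ℝ) ^ 2 := by
  rw [card_ne_zero_eq_sum]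
  exact Finset.sum_le_sum fun i _ => indicator_ne_zero_le_sq (q i)

/-- The slack identity: `∑ qᵢ² − #{qᵢ ≠ 0} = ∑_{qᵢ ≠ 0} (qᵢ² − 1)` — one unit of slack for every visit beyond
`|Q| = 1`, three for a `|Q| = 2` visit, etc. -/
theorem sum_sq_sub_card_ne_zero :
    (∑ i ∈ s, (q i : ℝ) ^ 2) - ((s.filter fun i => q i ≠ 0).card : ℝ) =
      ∑ i ∈ s.filter (fun i => q i ≠ 0), ((q i : ℝ) ^ 2 - 1) := by
  rw [card_ne_zero_eq_sum, ← Finset.sum_sub_distrib, Finset.sum_filter]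
  refine Finset.sum_congr rfl fun i _ => ?_
  split_ifs with h
  · rfl
  · push Not at h
    simp [h]

/-- The two sector counts add up: `#{qᵢ = 0} + #{qᵢ ≠ 0} = N`. -/
theorem card_zero_add_card_ne_zero :
    (s.filter fun i => q i = 0).card + (s.filter fun i => q i ≠ 0).card = s.card := by
  rw [Finset.card_filter_add_card_filter_not]

/-- **`P̂(Q = 0) ≥ 1 − ⟨Q²⟩̂`** for every finite sample of an integer charge. -/
theorem one_sub_meanSq_le_zeroFraction (hs : s.Nonempty) :
    1 - (∑ i ∈ s, (q i : ℝ) ^ 2) / s.card ≤ ((s.filter fun i => q i = 0).card : ℝ) / s.card := by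
  have hN : (0 : ℝ) < s.card := by exact_mod_cast hs.card_pos
  have hsum := card_zero_add_card_ne_zero s q
  have hle := card_ne_zero_le_sum_sq s q
  rw [sub_le_iff_le_add, ← add_div, le_div_iff₀ hN, one_mul]
  have h' : (s.card : ℝ) = ((s.filter fun i => q i = 0).card : ℝ) + ((s.filter fun i => q i ≠ 0).card : ℝ) := by
    exact_mod_cast hsum.symm
  linarith

/-- Equality `P̂(Q = 0) = 1 − ⟨Q²⟩̂` holds iff the sample never leaves `|Q| ≤ 1`. -/
theorem zeroFraction_eq_one_sub_meanSq_iff (hs : s.Nonempty) :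
    ((s.filter fun i => q i = 0).card : ℝ) / s.card = 1 - (∑ i ∈ s, (q i : ℝ) ^ 2) / s.card ↔ ∀ i ∈ s, |q i| ≤ 1 := by
  have hN : (0 : ℝ) < s.card := by exact_mod_cast hs.card_pos
  have hsum : (s.card : ℝ) = ((s.filter fun i => q i = 0).card : ℝ) + ((s.filter fun i => q i ≠ 0).card : ℝ) := by
    exact_mod_cast (card_zero_add_card_ne_zero s q).symm
  -- equality ⇔ the slack vanishes ⇔ every term of the slack sum vanishes
  have key : ((s.filter fun i => q i = 0).card : ℝ) / s.card = 1 - (∑ i ∈ s, (q i : ℝ) ^ 2) / s.card ↔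
      (∑ i ∈ s, (q i : ℝ) ^ 2) - ((s.filter fun i => q i ≠ 0).card : ℝ) = 0 := by
    rw [eq_sub_iff_add_eq, ← add_div, div_eq_one_iff_eq hN.ne']
    constructor <;> intro h <;> linarith
  rw [key, sum_sq_sub_card_ne_zero,
    Finset.sum_eq_zero_iff_of_nonneg fun i hi => by
      have := indicator_ne_zero_le_sq (q i)
      rw [if_pos (Finset.mem_filter.mp hi).2] at this
      linarith]
  constructor
  · intro h i hi
    by_cases hq : q i = 0
    · simp [hq]
    · have := h i (Finset.mem_filter.mpr ⟨hi, hq⟩)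
      have h0 := (sq_sub_indicator_eq_zero_iff (q i)).mp (by rw [if_pos hq]; linarith)
      exact h0
  · intro h i hi
    obtain ⟨his, hq⟩ := Finset.mem_filter.mp hi
    have := (sq_sub_indicator_eq_zero_iff (q i)).mpr (h i his)
    rw [if_pos hq] at this
    linarith

/-- **The `P-c` trigger forces a trivial-sector majority**: `⟨Q²⟩̂ < ½ ⟹ P̂(Q = 0) > ½`. -/
theorem half_lt_zeroFraction (hs : s.Nonempty) (h : (∑ i ∈ s, (q i : ℝ) ^ 2) / s.card < 1 / 2) :
    1 / 2 < ((s.filter fun i => q i = 0).card : ℝ) / s.card := by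
  have := one_sub_meanSq_le_zeroFraction s q hs
  linarith

/-- Conversely a populated charge distribution keeps `P-c` quiet: `P̂(Q = 0) ≤ ½ ⟹ ⟨Q²⟩̂ ≥ ½`. -/
theorem half_le_meanSq (hs : s.Nonempty) (h : ((s.filter fun i => q i = 0).card : ℝ) / s.card ≤ 1 / 2) :
    1 / 2 ≤ (∑ i ∈ s, (q i : ℝ) ^ 2) / s.card := by
  have := one_sub_meanSq_le_zeroFraction s q hs
  linarith

end Sample

/-! ## §3 Laws -/

section Law

variable {Ω : Type*} [MeasurableSpace Ω] (μ : Measure Ω) [IsProbabilityMeasure μ] {Q : Ω → ℤ}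

/-- **`ℙ(Q ≠ 0) ≤ 𝔼 Q²`** for an integer-valued random variable with `Q²` integrable. -/
theorem measureReal_ne_zero_le_integral_sq (hQ : Measurable Q) (hint : Integrable (fun ω => ((Q ω : ℝ)) ^ 2) μ) :
    μ.real {ω | Q ω ≠ 0} ≤ ∫ ω, ((Q ω : ℝ)) ^ 2 ∂μ := by
  have hmeas : MeasurableSet {ω | Q ω ≠ 0} := hQ (measurableSet_singleton (0 : ℤ)).compl
  rw [← integral_indicator_one hmeas]
  refine integral_mono ((integrable_const (1 : ℝ)).indicator hmeas) hint fun ω => ?_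
  simp only [Set.indicator_apply, Set.mem_setOf_eq, Pi.one_apply]
  exact indicator_ne_zero_le_sq (Q ω)

/-- **`ℙ(Q = 0) ≥ 1 − 𝔼 Q²`**: a small second moment of an integer charge means most of the mass sits in the trivial
sector (the law counterpart of `one_sub_meanSq_le_zeroFraction`). -/
theorem one_sub_integral_sq_le_measureReal_zero (hQ : Measurable Q)
    (hint : Integrable (fun ω => ((Q ω : ℝ)) ^ 2) μ) :
    1 - ∫ ω, ((Q ω : ℝ)) ^ 2 ∂μ ≤ μ.real {ω | Q ω = 0} := by
  have hmeas : MeasurableSet {ω | Q ω = 0} := hQ (measurableSet_singleton (0 : ℤ))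
  have hcompl : {ω | Q ω ≠ 0} = {ω | Q ω = 0}ᶜ := by ext ω; simp
  have h1 : μ.real {ω | Q ω ≠ 0} = 1 - μ.real {ω | Q ω = 0} := by
    rw [hcompl, measureReal_compl hmeas, probReal_univ]
  have h2 := measureReal_ne_zero_le_integral_sq μ hQ hint
  linarith

/-- The `P-c` trigger at the level of laws: `𝔼 Q² < ½ ⟹ ℙ(Q = 0) > ½`. -/
theorem half_lt_measureReal_zero (hQ : Measurable Q) (hint : Integrable (fun ω => ((Q ω : ℝ)) ^ 2) μ)
    (h : ∫ ω, ((Q ω : ℝ)) ^ 2 ∂μ < 1 / 2) : 1 / 2 < μ.real {ω | Q ω = 0} := by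
  have := one_sub_integral_sq_le_measureReal_zero μ hQ hint
  linarith

end Law

/-! ## §4 The `(β, L/a) = (2.5, 8)` rows of row 16's Q0-REPORT as arithmetic -/

section Q0Report

/-- Q0-REPORT, `(2.5, 8⁴)`, arm E1 (C16b canary, `N = 900`), sector counts `{−2:1, −1:28, 0:853, 1:18}`:
`∑ q² = 4·1 + 1·28 + 1·18 = 50`, `#{q ≠ 0} = 47`, slack `3` (the single `|Q| = 2` visit), and the bound
`P̂(0) = 853/900 ≥ 1 − 50/900` holds with room `3/900`. -/
theorem q0report_b25_L8_E1 :
    (1 + 28 + 853 + 18 = (900 : ℕ)) ∧ ((-2 : ℤ) ^ 2 * 1 + (-1) ^ 2 * 28 + 0 ^ 2 * 853 + 1 ^ 2 * 18 = 50) ∧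
      (1 + 28 + 18 = (47 : ℕ)) ∧ ((1 : ℝ) - 50 / 900 ≤ 853 / 900) ∧ ((853 : ℝ) / 900 - (1 - 50 / 900) = 3 / 900) := by
  norm_num

/-- Q0-REPORT, `(2.5, 8⁴)`, arm E2 (C16b canary, `N = 1960`), sector counts `{−1:48, 0:1835, 1:77}`: no `|Q| ≥ 2`
visit, so the bound is an equality, `P̂(0) = 1835/1960 = 1 − 125/1960` (printed: `0.936`, `⟨Q²⟩ = 0.064`). -/
theorem q0report_b25_L8_E2 :
    (48 + 1835 + 77 = (1960 : ℕ)) ∧ ((-1 : ℤ) ^ 2 * 48 + 0 ^ 2 * 1835 + 1 ^ 2 * 77 = 125) ∧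
      ((1835 : ℝ) / 1960 = 1 - 125 / 1960) := by
  norm_num

end Q0Report

end Summit.Ventures.LatticeQCDFlow.Scoring
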